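import Summits.Ventures.PercRepro.C026PFunHalfEM

/-!
# The band is closed under gluing, and `(P)` = total slack − covariance (p6, gen 16; mine-3 §26 (a))

The lower corner `K_min(z) = max 0 ((2z − 1)/(2 − z))` is sub-multiplicative on `[0, 1]`
(`kMin_mul_le`: LEMMA G2 in corner form — the glued state of two band states is a band state), so
the glued state `(X_c(ω), K_c(ω))` of the probe's cluster is a band state in every configuration
(`kMin_xCluster_le_kCluster`) and its slack `Δ(X_c(ω), K_c(ω))` is `≥ 0`.  The (P) functional is
the TOTAL CONFIGURATION SLACK `∑_ω N_c(ω)·Δ(X_c(ω), K_c(ω)) ≥ 0` minus the covariance of `(K_c, n̄)`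
over complementary pairs, `½·∑_ω (K_c(ω) − K_c(ω^c))·(n̄(ω) − n̄(ω^c))` (`pFun_eq_totalSlack_sub_cov`):
CONJECTURE (P) says the slacks pay the covariance.
-/

namespace PercRepro

/-- `K_min` is nonnegative. -/
theorem kMin_nonneg (z : ℝ) : 0 ≤ kMin z := le_max_left _ _

/-- `K_min(z) = 0` for `z ≤ ½`. -/
theorem kMin_eq_zero_of_le {z : ℝ} (hz : z ≤ 1 / 2) : kMin z = 0 := by
  unfold kMin
  rw [max_eq_left]
  apply div_nonpos_of_nonpos_of_nonneg <;> linarith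

/-- `K_min(z) = (2z − 1)/(2 − z)` for `½ ≤ z ≤ 1`. -/
theorem kMin_eq_of_half_le {z : ℝ} (hz : 1 / 2 ≤ z) (hz2 : z ≤ 1) :
    kMin z = (2 * z - 1) / (2 - z) := by
  unfold kMin
  rw [max_eq_right]
  apply div_nonneg <;> linarith

/-- **LEMMA G2 in corner form**: `K_min` is sub-multiplicative on `[0, 1]` — the glued state of two
band states is a band state. -/
theorem kMin_mul_le {x y : ℝ} (hx : 0 ≤ x ∧ x ≤ 1) (hy : 0 ≤ y ∧ y ≤ 1) :
    kMin (x * y) ≤ kMin x * kMin y := by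
  have hxy : 0 ≤ x * y ∧ x * y ≤ 1 := ⟨mul_nonneg hx.1 hy.1, mul_le_one₀ hx.2 hy.1 hy.2⟩
  rcases le_or_gt (x * y) (1 / 2) with h | h
  · rw [kMin_eq_zero_of_le h]
    exact mul_nonneg (kMin_nonneg x) (kMin_nonneg y)
  · have hx2 : 1 / 2 ≤ x := by nlinarith
    have hy2 : 1 / 2 ≤ y := by nlinarith
    rw [kMin_eq_of_half_le h.le hxy.2, kMin_eq_of_half_le hx2 hx.2, kMin_eq_of_half_le hy2 hy.2]
    have h2x : 0 < 2 - x := by linarith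
    have h2y : 0 < 2 - y := by linarith
    have h2xy : 0 < 2 - x * y := by linarith
    rw [div_mul_div_comm, div_le_div_iff₀ h2xy (mul_pos h2x h2y)]
    have key : (2 * x - 1) * (2 * y - 1) * (2 - x * y) - (2 * x * y - 1) * ((2 - x) * (2 - y)) =
        6 * ((1 - x) * (1 - y) * (1 - x * y)) := by ring
    have : 0 ≤ (1 - x) * (1 - y) * (1 - x * y) :=
      mul_nonneg (mul_nonneg (by linarith) (by linarith)) (by linarith)
    linarith

namespace MultiGraph

open Finset

variable {V E : Type*} [Fintype V] {G : MultiGraph V E}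

omit [Fintype V] in
/-- The band is closed under gluing over any finite set of vertices:
`K_min(∏_{v ∈ R} x v) ≤ ∏_{v ∈ R} K v` when every `(x v, K v)` is a band state. -/
theorem kMin_prod_le_prod {x K : V → ℝ} (hx : ∀ v, 0 ≤ x v ∧ x v ≤ 1)
    (hK : ∀ v, kMin (x v) ≤ K v) (R : Finset V) :
    kMin (∏ v ∈ R, x v) ≤ ∏ v ∈ R, K v := by
  classical
  induction R using Finset.induction_on with
  | empty =>
    simp only [Finset.prod_empty]
    unfold kMin
    rw [max_eq_right (by norm_num)]
    norm_num
  | insert v R hv ih =>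
    rw [Finset.prod_insert hv, Finset.prod_insert hv]
    have hR : 0 ≤ ∏ w ∈ R, x w ∧ ∏ w ∈ R, x w ≤ 1 :=
      ⟨Finset.prod_nonneg fun w _ => (hx w).1,
        Finset.prod_le_one (fun w _ => (hx w).1) (fun w _ => (hx w).2)⟩
    calc kMin (x v * ∏ w ∈ R, x w) ≤ kMin (x v) * kMin (∏ w ∈ R, x w) := kMin_mul_le (hx v) hR
      _ ≤ K v * ∏ w ∈ R, K w :=
        mul_le_mul (hK v) ih (kMin_nonneg _) ((kMin_nonneg _).trans (hK v))

/-- The glued state of the probe's cluster is a band state in every configuration. -/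
theorem kMin_xCluster_le_kCluster {x K : V → ℝ} (hx : ∀ v, 0 ≤ x v ∧ x v ≤ 1)
    (hK : ∀ v, kMin (x v) ≤ K v) (c : V) (ω : Config E) :
    kMin (G.xCluster x c ω) ≤ G.kCluster K c ω :=
  kMin_prod_le_prod hx hK _

/-- The slack of the probe's cluster is nonnegative in every configuration. -/
theorem slackOne_cluster_nonneg {x K : V → ℝ} (hx : ∀ v, 0 ≤ x v ∧ x v ≤ 1)
    (hK : ∀ v, kMin (x v) ≤ K v) (c : V) (ω : Config E) :
    0 ≤ slackOne (G.xCluster x c ω) (G.kCluster K c ω) :=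
  slackOne_nonneg_of_kMin_le (xCluster_mem hx c ω).2 (kMin_xCluster_le_kCluster hx hK c ω)

section TotalSlack

variable [DecidableEq V] [Fintype E] [DecidableEq E]

variable (G) in
/-- The total configuration slack `∑_{ω ⊆ F} N_c(ω)·Δ(X_c(ω), K_c(ω))`. -/
noncomputable def totalSlack (c : V) (x K : V → ℝ) (F : Finset E) : ℝ :=
  ∑ ω ∈ configsIn F, G.nbarOff x c ω * slackOne (G.xCluster x c ω) (G.kCluster K c ω)

variable (G) in
/-- The covariance of `(K_c, n̄)` over complementary pairs of configurations. -/
noncomputable def pairCov (c : V) (x K : V → ℝ) (F : Finset E) : ℝ :=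
  ∑ ω ∈ configsIn F,
    (G.kCluster K c ω - G.kCluster K c (complIn F ω)) * (G.nbar x ω - G.nbar x (complIn F ω))

/-- The total configuration slack is nonnegative at every band state (LEMMA G2). -/
theorem totalSlack_nonneg {c : V} {x K : V → ℝ} (hx : ∀ v, 0 ≤ x v ∧ x v ≤ 1)
    (hK : ∀ v, kMin (x v) ≤ K v) (F : Finset E) : 0 ≤ G.totalSlack c x K F :=
  Finset.sum_nonneg fun ω _ => mul_nonneg (nbarOff_nonneg hx c ω) (slackOne_cluster_nonneg hx hK c ω)

/-- **`(P)` = total slack − ½·covariance** (mine-3 §26 (a)):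
`(P_F) = ∑_ω N_c(ω)Δ(X_c(ω), K_c(ω)) − ½ ∑_ω (K_c(ω) − K_c(ω^c))(n̄(ω) − n̄(ω^c))`. -/
theorem pFun_eq_totalSlack_sub_cov (c : V) (x K : V → ℝ) (F : Finset E) :
    G.pFun c x K F = G.totalSlack c x K F - G.pairCov c x K F / 2 := by
  unfold pFun totalSlack pairCov
  -- the two reindexed sums
  have h1 : ∑ ω ∈ configsIn F, G.kCluster K c (complIn F ω) * G.nbar x (complIn F ω) =
      ∑ ω ∈ configsIn F, G.kCluster K c ω * G.nbar x ω :=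
    sum_complIn_eq F fun ω => G.kCluster K c ω * G.nbar x ω
  have h2 : ∑ ω ∈ configsIn F, G.kCluster K c (complIn F ω) * G.nbar x ω =
      ∑ ω ∈ configsIn F, G.kCluster K c ω * G.nbar x (complIn F ω) := by
    rw [← sum_complIn_eq F fun ω => G.kCluster K c ω * G.nbar x (complIn F ω)]
    refine Finset.sum_congr rfl fun ω hω => ?_
    rw [complIn_complIn hω]
  have hcov : ∑ ω ∈ configsIn F,
      (G.kCluster K c ω - G.kCluster K c (complIn F ω)) * (G.nbar x ω - G.nbar x (complIn F ω)) =
      ∑ ω ∈ configsIn F, G.kCluster K c ω * G.nbar x ω -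
        ∑ ω ∈ configsIn F, G.kCluster K c ω * G.nbar x (complIn F ω) -
        ∑ ω ∈ configsIn F, G.kCluster K c (complIn F ω) * G.nbar x ω +
        ∑ ω ∈ configsIn F, G.kCluster K c (complIn F ω) * G.nbar x (complIn F ω) := by
    rw [Finset.sum_congr rfl fun ω _ => show
      (G.kCluster K c ω - G.kCluster K c (complIn F ω)) * (G.nbar x ω - G.nbar x (complIn F ω)) =
        G.kCluster K c ω * G.nbar x ω - G.kCluster K c ω * G.nbar x (complIn F ω) -
          G.kCluster K c (complIn F ω) * G.nbar x ω +
          G.kCluster K c (complIn F ω) * G.nbar x (complIn F ω) by ring]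
    rw [Finset.sum_add_distrib, Finset.sum_sub_distrib, Finset.sum_sub_distrib]
  have htot : ∑ ω ∈ configsIn F, G.nbarOff x c ω * slackOne (G.xCluster x c ω) (G.kCluster K c ω) =
      ∑ ω ∈ configsIn F, G.nbarOff x c ω * (1 - 2 * G.xCluster x c ω) +
        ∑ ω ∈ configsIn F, G.kCluster K c ω * G.nbar x ω := by
    rw [Finset.sum_congr rfl fun ω _ => show
      G.nbarOff x c ω * slackOne (G.xCluster x c ω) (G.kCluster K c ω) =
        G.nbarOff x c ω * (1 - 2 * G.xCluster x c ω) + G.kCluster K c ω * G.nbar x ω by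
        rw [nbar_eq_mul_nbarOff G x c]; unfold slackOne; ring]
    rw [Finset.sum_add_distrib]
  rw [Finset.sum_add_distrib, htot, hcov, h1, h2]
  ring

end TotalSlack

end MultiGraph

end PercRepro
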